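import Mathlib.Data.Matrix.Mul
import Mathlib.Data.Matrix.Basic
import Literature.AlgebraicGeometry.HodgeTheory.BlochSemiregularityMapReal
import HarnessLib

/-!
# Venture HSemireg — exact certificates for Bloch semiregularity: what the engine's matrix must be, and how a
# right inverse (resp. a left-kernel vector) decides `IsBlochSemiregular`

HONEST FRAMING. Interface file of a COMPUTATION cell (`pub-hsemireg`); no claim about any variety is made. The
tree DEFINES Bloch semiregularity of a closed subscheme `i : Z ↪ X` (`X` of dimension `n`, `Z` a local
complete intersection of codimension `p = r + 1`, `m = n - p = k + 1`) on REAL carriers as SURJECTIVITY of one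
additive map between two coherent cohomology groups,
`blochPairingMap i r (m+1) k : H^{m-1}(X, Ω^{m+1}_X) →+ H^{m-1}(X, 𝓐lt_r(𝓘; Ωⁿ_X|_Z)) (= H^{m-1}(Z, 𝒩^∨ ⊗ ω_Z))`
— the map Bloch (§1) and Buchweitz–Flenner ((8.1)(2)) transpose by Serre duality to DEFINE
`π : H¹(Z, 𝒩_{Z/X}) → H^{p+1}(X, Ω^{p-1}_X)` (`Literature/…/BlochSemiregularityMapReal.lean`, `IsBlochSemiregular`,
`isBlochSemiregular_iff`). The cell's engines compute exactly this map for explicit `(X, Z)` (CM abelian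
varieties, explicit lci cycles) as a MATRIX over a number field. This file fixes the contract between the two:

* `BlochPairingCoordinates i r j k L` — COORDINATES (hypothesis structure, D-0014): additive bijections of the
  source `Hᵏ(X, Ωʲ_X)` and the target `Hᵏ(X, 𝓐lt_r(𝓘; Ω^{j+r}_X|_Z))` of `blochPairingMap i r j k` with
  `Fin a → L`, `Fin b → L` (`L` a commutative ring; intended `ℂ`, or the field of definition), and a matrix
  `M ∈ L^{b × a}` such that the square commutes: `tgt (blochPairingMap x) = M *ᵥ src x`. THIS IS THE ENGINE'S
  MODELLING CLAIM — "my matrix is the matrix of the tree's map in some bases" — and it is NOT checkable by the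
  kernel today (the tree cannot compute coherent cohomology of `E⁶`); it is exactly what the cell's STEP-0 /
  second-engine cross-checks vouch for. Everything below is proved relative to it.
* `surjective_iff` — under coordinates, surjectivity of the tree's map is surjectivity of `M *ᵥ ·`.
* CERTIFICATES (pure linear algebra, kernel-checked here once and for all):
  `mulVec_surjective_of_mul_eq_one` — a right inverse `R ∈ L^{a × b}`, `M * R = 1`, proves surjectivity;
  `mulVec_not_surjective_of_vecMul_eq_zero` — a non-zero left-kernel vector `y ∈ L^b`, `y ᵥ* M = 0`, refutes it;
  and their versions for a matrix with entries in a subring/number field `K` mapped into `L` by an injective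
  ring map `f` (`Matrix.map`), which is how an exact `ℚ(√-d)`-matrix certifies a statement about `ℂ`-groups.
* VERDICTS: `isBlochSemiregular_of_certificate` (`M * R = 1` ⟹ `IsBlochSemiregular i n p`) and
  `not_isBlochSemiregular_of_certificate` (`y ≠ 0`, `y ᵥ* M = 0` ⟹ `¬ IsBlochSemiregular i n p`), with the
  degree bookkeeping `r + 1 = p`, `m + p = n`, `k + 1 = m` of `isBlochSemiregular_iff` explicit — no truncated
  subtraction.

So a census row of the cell = (description of the bases, `M`, and EITHER `R` OR `y`), all exact; the row's
Boolean is then a theorem of this file modulo the coordinates. Rank / dimension counts alone are NOT accepted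
as certificates here (a rank is not kernel-checkable data; `R` and `y` are).

References: [Bloch1972Semiregularity] S. Bloch, Invent. Math. 17 (1972), §1; [BuchweitzFlenner2003]
R.-O. Buchweitz, H. Flenner, Compositio Math. 137 (2003), (8.1)–Prop. 8.2.
-/

noncomputable section

open CategoryTheory AlgebraicGeometry Matrix

universe u v w

namespace Summit.Ventures.HSemireg

/-! ## Pure linear algebra: the two certificate shapes -/

section Certificates

variable {L : Type v} [CommRing L] {a b : ℕ}

/-- **Right-inverse certificate.** If `M * R = 1` then `x ↦ M *ᵥ x` is surjective (`y = M *ᵥ (R *ᵥ y)`).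
[folklore] -/
theorem mulVec_surjective_of_mul_eq_one (M : Matrix (Fin b) (Fin a) L) (R : Matrix (Fin a) (Fin b) L)
    (h : M * R = 1) : Function.Surjective M.mulVec :=
  fun y => ⟨R.mulVec y, by rw [Matrix.mulVec_mulVec, h, Matrix.one_mulVec]⟩

/-- **Left-kernel certificate.** If `y ≠ 0` and `y ᵥ* M = 0` then `x ↦ M *ᵥ x` is not surjective: every value
is orthogonal to `y` (`y ⬝ᵥ (M *ᵥ x) = (y ᵥ* M) ⬝ᵥ x = 0`), but `y ⬝ᵥ eᵢ = yᵢ ≠ 0` for some `i`. (Over a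
field this is also necessary; only sufficiency is needed for a certificate.) [folklore] -/
theorem mulVec_not_surjective_of_vecMul_eq_zero (M : Matrix (Fin b) (Fin a) L) (y : Fin b → L) (hy : y ≠ 0)
    (h : Matrix.vecMul y M = 0) : ¬ Function.Surjective M.mulVec := by
  intro hs
  obtain ⟨i, hi⟩ : ∃ i, y i ≠ 0 := Function.ne_iff.mp hy
  obtain ⟨x, hx⟩ := hs (Pi.single i 1)
  have h1 : y ⬝ᵥ (M.mulVec x) = 0 := by
    rw [Matrix.dotProduct_mulVec, h, zero_dotProduct]
  rw [hx, dotProduct_single, mul_one] at h1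
  exact hi h1

variable {K : Type w} [CommRing K]

/-- **Right-inverse certificate over a smaller ring.** If `M = M₀.map f` for a ring map `f : K →+* L` and
`M₀ * R₀ = 1` over `K` (exact arithmetic in the number field `K`), then `M *ᵥ ·` is surjective over `L`.
[folklore] -/
theorem mulVec_surjective_of_map_of_mul_eq_one (f : K →+* L) (M₀ : Matrix (Fin b) (Fin a) K)
    (R₀ : Matrix (Fin a) (Fin b) K) (h : M₀ * R₀ = 1) :
    Function.Surjective (M₀.map f).mulVec :=
  mulVec_surjective_of_mul_eq_one (M₀.map f) (R₀.map f)
    (by rw [← Matrix.map_mul, h, Matrix.map_one f (map_zero f) (map_one f)])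

/-- **Left-kernel certificate over a smaller ring.** If `f : K →+* L` is injective, `y₀ ≠ 0` and `y₀ ᵥ* M₀ = 0`
over `K`, then `(M₀.map f) *ᵥ ·` is not surjective over `L`. [folklore] -/
theorem mulVec_not_surjective_of_map_of_vecMul_eq_zero (f : K →+* L) (hf : Function.Injective f)
    (M₀ : Matrix (Fin b) (Fin a) K) (y₀ : Fin b → K) (hy : y₀ ≠ 0) (h : Matrix.vecMul y₀ M₀ = 0) :
    ¬ Function.Surjective (M₀.map f).mulVec := by
  refine mulVec_not_surjective_of_vecMul_eq_zero (M₀.map f) (f ∘ y₀) ?_ ?_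
  · intro h0
    apply hy
    funext i
    apply hf
    have hi := congrFun h0 i
    simp only [Function.comp_apply, Pi.zero_apply] at hi
    rw [hi, Pi.zero_apply, map_zero]
  · funext j
    have hj := congrArg f (congrFun h j)
    rw [Pi.zero_apply, map_zero] at hj
    rw [Pi.zero_apply, ← hj, ← RingHom.map_vecMul]

/-- **Sandwich certificate** (the shape of a RANK argument `rank(N·M) = b = dim target ⟹ M surjective`): if
`Q_L * (N * M * R) = 1` for some `N ∈ L^{c×b}`, `R ∈ L^{a×b}`, `Q_L ∈ L^{b×c}`, then the square matrix `M * R` has the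
left inverse `Q_L * N`, hence (commutative ring) also `M * R * (Q_L * N) = 1`, so `M` has a right inverse and `M *ᵥ ·` is
surjective. Used when an engine knows only a COMPOSITE `N·M` (e.g. the cup product `ξ ↦ ξ ∪ [Z]` on `H¹(T_X)`, Bloch
(2.5)/(6.8): `c = π ∘ r`) of full rank `b = h¹(Z, 𝒩)` rather than Bloch's map itself. [folklore] -/
theorem mulVec_surjective_of_sandwich {c : ℕ} (M : Matrix (Fin b) (Fin a) L) (N : Matrix (Fin c) (Fin b) L)
    (R : Matrix (Fin a) (Fin b) L) (QL : Matrix (Fin b) (Fin c) L) (h : QL * (N * M * R) = 1) :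
    Function.Surjective M.mulVec := by
  have h1 : (QL * N) * (M * R) = 1 := by
    rw [← h]; simp only [Matrix.mul_assoc]
  have h2 : (M * R) * (QL * N) = 1 := mul_eq_one_comm.mp h1
  exact mulVec_surjective_of_mul_eq_one M (R * (QL * N)) (by rw [← h2]; simp only [Matrix.mul_assoc])

/-- Sandwich certificate over a smaller ring (`M = M₀.map f`, all of `N₀, R₀, Q₀` over `K`, identity checked over `K`).
[folklore] -/
theorem mulVec_surjective_of_map_of_sandwich {c : ℕ} (f : K →+* L) (M₀ : Matrix (Fin b) (Fin a) K)
    (N₀ : Matrix (Fin c) (Fin b) K) (R₀ : Matrix (Fin a) (Fin b) K) (QL₀ : Matrix (Fin b) (Fin c) K)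
    (h : QL₀ * (N₀ * M₀ * R₀) = 1) : Function.Surjective (M₀.map f).mulVec :=
  mulVec_surjective_of_sandwich (M₀.map f) (N₀.map f) (R₀.map f) (QL₀.map f)
    (by rw [← Matrix.map_mul, ← Matrix.map_mul, ← Matrix.map_mul, h, Matrix.map_one f (map_zero f) (map_one f)])

end Certificates

/-! ## Coordinates for the tree's Bloch pairing map, and the verdicts -/

section Coordinates

open Literature.AlgebraicGeometry.HodgeTheory Literature.AlgebraicGeometry.Motives
  Literature.AlgebraicGeometry.Modules Literature.AlgebraicGeometry.Deformation

variable {S : Type u} [CommRing S] {X : Over (Spec (CommRingCat.of S))} {Z : Scheme.{u}}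
  (i : Z ⟶ X.left) (r j k : ℕ) (L : Type v) [CommRing L]

/-- **Coordinates for Bloch's pairing map** `blochPairingMap i r j k : Hᵏ(X, Ωʲ_X) →+ Hᵏ(X, 𝓐lt_r(𝓘; Ω^{j+r}_X|_Z))`
(hypothesis structure, D-0014): additive bijections `src : Hᵏ(X, Ωʲ_X) ≃+ Lᵃ`, `tgt : Hᵏ(X, 𝓐lt_r(…)) ≃+ Lᵇ` and a
matrix `M ∈ L^{b×a}` with `tgt (blochPairingMap x) = M *ᵥ (src x)` for all `x` — "`M` is the matrix of the map
in the chosen coordinates". For `X` smooth projective of dimension `n = j + r` over a field `S = L`, `Z` a local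
complete intersection of codimension `r + 1`, `j = m + 1`, `k = m - 1` (`m = dim Z`), these are bases of the two
finite-dimensional spaces `H^{m-1}(X, Ω^{m+1}_X)` and `H^{m-1}(Z, 𝒩^∨ ⊗ ω_Z)` and `M` is the matrix of the map
that Bloch / Buchweitz–Flenner dualise to define `π` (BF (8.1)(2)). The structure is the engine's MODELLING
CLAIM; nothing in the tree constructs an instance. [cite: BuchweitzFlenner2003, (8.1) (1)-(2)]
[cite: Bloch1972Semiregularity, §1] -/
structure BlochPairingCoordinates where
  /-- `a = dim Hᵏ(X, Ωʲ_X)` (number of source coordinates). -/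
  srcDim : ℕ
  /-- `b = dim Hᵏ(X, 𝓐lt_r(𝓘; Ω^{j+r}_X|_Z))` (number of target coordinates). -/
  tgtDim : ℕ
  /-- Source coordinates `Hᵏ(X, Ωʲ_X) ≃+ (Fin a → L)`. -/
  src : hodgeCohomology X j k ≃+ (Fin srcDim → L)
  /-- Target coordinates `Hᵏ(X, 𝓐lt_r(𝓘; Ω^{j+r}_X|_Z)) ≃+ (Fin b → L)`. -/
  tgt : moduleSheafCohomology (altMultiHom (idealModule i) (formsOnSubscheme i (pairingDegree r j)) r) k ≃+
    (Fin tgtDim → L)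
  /-- The matrix of `blochPairingMap i r j k` in these coordinates (`b × a`). -/
  matrix : Matrix (Fin tgtDim) (Fin srcDim) L
  /-- The square commutes: `tgt ∘ blochPairingMap = (M *ᵥ ·) ∘ src`. -/
  tgt_apply (x : hodgeCohomology X j k) : tgt (blochPairingMap i r j k x) = matrix.mulVec (src x)

namespace BlochPairingCoordinates

variable {i r j k L} (C : BlochPairingCoordinates i r j k L)

/-- Under coordinates, the tree's map is surjective iff `M *ᵥ ·` is. [folklore] -/
theorem surjective_iff : Function.Surjective (blochPairingMap i r j k) ↔ Function.Surjective C.matrix.mulVec := by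
  constructor
  · intro h v
    obtain ⟨x, hx⟩ := h (C.tgt.symm v)
    refine ⟨C.src x, ?_⟩
    rw [← C.tgt_apply, hx, AddEquiv.apply_symm_apply]
  · intro h t
    obtain ⟨v, hv⟩ := h (C.tgt t)
    refine ⟨C.src.symm v, C.tgt.injective ?_⟩
    rw [C.tgt_apply, AddEquiv.apply_symm_apply, hv]

/-- **Verdict: semiregular.** Coordinates in the Bloch degrees (`j = m + 1`, `r + 1 = p`, `m + p = n`,
`k + 1 = m`) and a right inverse `R` of the matrix (`M * R = 1`) prove `IsBlochSemiregular i n p` — i.e. (BF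
(8.1)(2)) injectivity of Bloch's `π : H¹(Z, 𝒩) → H^{p+1}(X, Ω^{p-1})`. [cite: BuchweitzFlenner2003, (8.1) (2)]
[cite: Bloch1972Semiregularity, §1] -/
theorem isBlochSemiregular_of_certificate {n p m : ℕ} (hp : r + 1 = p) (hn : m + p = n) (hk : k + 1 = m)
    (hj : j = m + 1) (R : Matrix (Fin C.srcDim) (Fin C.tgtDim) L) (hR : C.matrix * R = 1) :
    IsBlochSemiregular i n p := by
  subst hj
  exact (isBlochSemiregular_iff hp hn hk).2 (C.surjective_iff.2 (mulVec_surjective_of_mul_eq_one _ R hR))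

/-- **Verdict: NOT semiregular.** Coordinates in the Bloch degrees and a non-zero left-kernel vector `y`
(`y ᵥ* M = 0`) prove `¬ IsBlochSemiregular i n p` (Bloch's `π` has a kernel). [cite: BuchweitzFlenner2003, (8.1) (2)]
[cite: Bloch1972Semiregularity, §1] -/
theorem not_isBlochSemiregular_of_certificate {n p m : ℕ} (hp : r + 1 = p) (hn : m + p = n) (hk : k + 1 = m)
    (hj : j = m + 1) (y : Fin C.tgtDim → L) (hy : y ≠ 0) (hyM : Matrix.vecMul y C.matrix = 0) :
    ¬ IsBlochSemiregular i n p := by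
  subst hj
  rw [isBlochSemiregular_iff hp hn hk, C.surjective_iff]
  exact mulVec_not_surjective_of_vecMul_eq_zero _ y hy hyM

/-- **Verdict: semiregular, exact arithmetic in a subring.** If the matrix is `M₀.map f` for a ring map
`f : K →+* L` (e.g. `K = ℚ(√-d) ↪ ℂ`) and `M₀ * R₀ = 1` over `K`, then `IsBlochSemiregular i n p`.
[cite: BuchweitzFlenner2003, (8.1) (2)] -/
theorem isBlochSemiregular_of_certificate_map {n p m : ℕ} (hp : r + 1 = p) (hn : m + p = n) (hk : k + 1 = m)
    (hj : j = m + 1) {K : Type w} [CommRing K] (f : K →+* L) (M₀ : Matrix (Fin C.tgtDim) (Fin C.srcDim) K)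
    (hM : C.matrix = M₀.map f) (R₀ : Matrix (Fin C.srcDim) (Fin C.tgtDim) K) (hR : M₀ * R₀ = 1) :
    IsBlochSemiregular i n p := by
  subst hj
  refine (isBlochSemiregular_iff hp hn hk).2 (C.surjective_iff.2 ?_)
  rw [hM]
  exact mulVec_surjective_of_map_of_mul_eq_one f M₀ R₀ hR

/-- **Verdict: NOT semiregular, exact arithmetic in a subring.** If the matrix is `M₀.map f` for an INJECTIVE
ring map `f : K →+* L`, `y₀ ≠ 0` and `y₀ ᵥ* M₀ = 0` over `K`, then `¬ IsBlochSemiregular i n p`.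
[cite: BuchweitzFlenner2003, (8.1) (2)] -/
theorem not_isBlochSemiregular_of_certificate_map {n p m : ℕ} (hp : r + 1 = p) (hn : m + p = n)
    (hk : k + 1 = m) (hj : j = m + 1) {K : Type w} [CommRing K] (f : K →+* L) (hf : Function.Injective f)
    (M₀ : Matrix (Fin C.tgtDim) (Fin C.srcDim) K) (hM : C.matrix = M₀.map f) (y₀ : Fin C.tgtDim → K)
    (hy : y₀ ≠ 0) (hyM : Matrix.vecMul y₀ M₀ = 0) : ¬ IsBlochSemiregular i n p := by
  subst hj
  rw [isBlochSemiregular_iff hp hn hk, C.surjective_iff, hM]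
  exact mulVec_not_surjective_of_map_of_vecMul_eq_zero f hf M₀ y₀ hy hyM

/-- **Verdict: semiregular, from a COMPOSITE of full rank (sandwich).** Coordinates `C` in the Bloch degrees, an
additive map `g` out of the TARGET of the tree's map whose expression in the target coordinates is a matrix `N`
(`g (tgt⁻¹ v) = N *ᵥ v`; intended: the Serre dual `r^∨` of the Kodaira–Spencer/obstruction map `r : H¹(X, T_X) → H¹(Z, 𝒩)`,
so that `g ∘ blochPairingMap` is the transpose of `c = π ∘ r = (ξ ↦ ξ ∪ [Z])`, Bloch (2.5)/(6.8)), and exact matrices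
`R`, `Q_L` with `Q_L * (N * M * R) = 1` (i.e. `rank (N·M) = b = dim H^{m-1}(Z, 𝒩^∨ ⊗ ω_Z) = h¹(Z, 𝒩)`) prove
`IsBlochSemiregular i n p`. This is the certificate shape of a verdict obtained as «`rank(ξ ↦ ξ ∪ [Z]) = h¹(Z, 𝒩_Z)`»
(the cell's STEP-0 class (A): `12 = 12`). The two MODELLING CLAIMS are `C.tgt_apply` (as always) and `hg`.
[cite: Bloch1972Semiregularity, §1, (2.5) and Prop. (6.8)] [cite: BuchweitzFlenner2003, (8.1) (2)] -/
theorem isBlochSemiregular_of_sandwich {n p m : ℕ} (hp : r + 1 = p) (hn : m + p = n) (hk : k + 1 = m)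
    (hj : j = m + 1) {c : ℕ} {G : Type w} [AddCommGroup G]
    (g : moduleSheafCohomology (altMultiHom (idealModule i) (formsOnSubscheme i (pairingDegree r j)) r) k →+ G)
    (out : G ≃+ (Fin c → L)) (N : Matrix (Fin c) (Fin C.tgtDim) L)
    (hg : ∀ v : Fin C.tgtDim → L, out (g (C.tgt.symm v)) = N.mulVec v)
    (R : Matrix (Fin C.srcDim) (Fin C.tgtDim) L) (QL : Matrix (Fin C.tgtDim) (Fin c) L)
    (h : QL * (N * C.matrix * R) = 1) : IsBlochSemiregular i n p := by
  subst hj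
  -- `hg` is recorded as the modelling claim tying `N` to `g`; the surjectivity of the tree's map needs only `h`
  have _hcomp : ∀ x, out (g (blochPairingMap i r (m + 1) k x)) = (N * C.matrix).mulVec (C.src x) := by
    intro x
    rw [← C.tgt.symm_apply_apply (blochPairingMap i r (m + 1) k x), hg, C.tgt_apply, Matrix.mulVec_mulVec]
  exact (isBlochSemiregular_iff hp hn hk).2 (C.surjective_iff.2 (mulVec_surjective_of_sandwich _ N R QL h))

end BlochPairingCoordinates

end Coordinates

end Summit.Ventures.HSemireg

end
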